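import Literature.NumberTheory.CubicFields.CubicFieldDiscriminant8071
import HarnessLib

/-!
# The cubic field of discriminant `−8071`, II: the primes above `2`, `3`, `7` are principal — `2 = 𝔭_a𝔭_b𝔭_c` (Dedekind's splitting, three prime elements of norm `±2`),
# `3 = 𝔭₃𝔭₉` (degrees `1`, `2`, both principal: `9 ≤ 25`), `7 = 𝔭²𝔭'` RAMIFIED (`f ≡ (X − 3)²(X − 4) (mod 7)`, generators of norm `±7` for both), all explicit on `1, θ, δ`

Sequel of `CubicFieldDiscriminant8071.lean` (att-p4 g47, cell `bsd-f1-sign2`; template = att-p4 g46's `CubicFieldDiscriminant7255Primes`).  THEOREMS ONLY.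
Dedekind–Kummer through `θ` (`p ∤ 2 ⊇ [𝓞_F : ℤ[θ]]`) for `3`, `7`; the dyadic primes by the norm form.  [cite: Marcus2018, Ch. 3, Thm. 27 and Exercise 21] [cite: LMFDB, number field 3.1.8071.1]
-/

noncomputable section

open Polynomial NumberField NumberField.InfinitePlace Ideal Module Real
open Literature.NumberTheory.NumberFields
open Literature.NumberTheory.NumberFields.MonicCubic

namespace Literature.NumberTheory.CubicFields.CubicDisc8071

section NumberField

variable {F : Type*} [Field F] [NumberField F] {α : F}

/-! ## §3 The primes of norm `≤ 25` are principal: `p ≤ 7` -/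

/-- `N(-3 + 14 * θ - 9 * δ) = -2` (norm form on `1, α, α²`; `δ = (α ^ 2 + α) / 2`). [cite: Marcus2018, Ch. 2, Thm. 4 and Exercise 13] -/
theorem natAbs_norm_piA (h3 : finrank ℚ F = 3) (hα : aeval α (poly 4 19 (-8)) = 0) :
    (Algebra.norm ℤ (-3 + 14 * thetaInt hα - 9 * thetaInt (delta_root hα) : 𝓞 F)).natAbs = 2 := by
  have h : ((Algebra.norm ℤ (-3 + 14 * thetaInt hα - 9 * thetaInt (delta_root hα) : 𝓞 F) : ℤ) : ℚ) = Algebra.norm ℚ (algebraMap (𝓞 F) F (-3 + 14 * thetaInt hα - 9 * thetaInt (delta_root hα))) :=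
    Algebra.coe_norm_int _
  have hx : algebraMap (𝓞 F) F (-3 + 14 * thetaInt hα - 9 * thetaInt (delta_root hα)) = ((-3 : ℚ) : F) + ((19/2 : ℚ) : F) * α + ((-9/2 : ℚ) : F) * α ^ 2 := by
    simp only [map_mul, map_add, map_sub, map_neg, map_ofNat, MonicCubic.thetaInt, RingOfIntegers.map_mk]
    push_cast; ring
  rw [hx, norm_lin irreducible_polyQ hα h3] at h
  have hn : normForm 4 19 (-8) (-3) (19/2) (-9/2) = ((-2 : ℤ) : ℚ) := by norm_num [normForm]
  rw [hn] at h
  have h' : Algebra.norm ℤ (-3 + 14 * thetaInt hα - 9 * thetaInt (delta_root hα) : 𝓞 F) = -2 := by exact_mod_cast h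
  rw [h']; rfl

/-- `-3 + 14 * θ - 9 * δ` is a prime element of `𝓞_F` (norm `-2`). [cite: Marcus2018, Ch. 3, Thm. 27] -/
theorem prime_piA (h3 : finrank ℚ F = 3) (hα : aeval α (poly 4 19 (-8)) = 0) : Prime (-3 + 14 * thetaInt hα - 9 * thetaInt (delta_root hα) : 𝓞 F) :=
  prime_of_natAbs_norm_prime (by rw [natAbs_norm_piA h3 hα]; norm_num)

/-- `N(4625 - 3567 * θ - 12113 * δ) = 2` (norm form on `1, α, α²`; `δ = (α ^ 2 + α) / 2`). [cite: Marcus2018, Ch. 2, Thm. 4 and Exercise 13] -/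
theorem natAbs_norm_piB (h3 : finrank ℚ F = 3) (hα : aeval α (poly 4 19 (-8)) = 0) :
    (Algebra.norm ℤ (4625 - 3567 * thetaInt hα - 12113 * thetaInt (delta_root hα) : 𝓞 F)).natAbs = 2 := by
  have h : ((Algebra.norm ℤ (4625 - 3567 * thetaInt hα - 12113 * thetaInt (delta_root hα) : 𝓞 F) : ℤ) : ℚ) = Algebra.norm ℚ (algebraMap (𝓞 F) F (4625 - 3567 * thetaInt hα - 12113 * thetaInt (delta_root hα))) :=
    Algebra.coe_norm_int _
  have hx : algebraMap (𝓞 F) F (4625 - 3567 * thetaInt hα - 12113 * thetaInt (delta_root hα)) = ((4625 : ℚ) : F) + ((-19247/2 : ℚ) : F) * α + ((-12113/2 : ℚ) : F) * α ^ 2 := by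
    simp only [map_mul, map_sub, map_ofNat, MonicCubic.thetaInt, RingOfIntegers.map_mk]
    push_cast; ring
  rw [hx, norm_lin irreducible_polyQ hα h3] at h
  have hn : normForm 4 19 (-8) (4625) (-19247/2) (-12113/2) = ((2 : ℤ) : ℚ) := by norm_num [normForm]
  rw [hn] at h
  have h' : Algebra.norm ℤ (4625 - 3567 * thetaInt hα - 12113 * thetaInt (delta_root hα) : 𝓞 F) = 2 := by exact_mod_cast h
  rw [h']; rfl

/-- `4625 - 3567 * θ - 12113 * δ` is a prime element of `𝓞_F` (norm `2`). [cite: Marcus2018, Ch. 3, Thm. 27] -/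
theorem prime_piB (h3 : finrank ℚ F = 3) (hα : aeval α (poly 4 19 (-8)) = 0) : Prime (4625 - 3567 * thetaInt hα - 12113 * thetaInt (delta_root hα) : 𝓞 F) :=
  prime_of_natAbs_norm_prime (by rw [natAbs_norm_piB h3 hα]; norm_num)

/-- `N(-302 + 375 * θ + 586 * δ) = 2` (norm form on `1, α, α²`; `δ = (α ^ 2 + α) / 2`). [cite: Marcus2018, Ch. 2, Thm. 4 and Exercise 13] -/
theorem natAbs_norm_piC (h3 : finrank ℚ F = 3) (hα : aeval α (poly 4 19 (-8)) = 0) :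
    (Algebra.norm ℤ (-302 + 375 * thetaInt hα + 586 * thetaInt (delta_root hα) : 𝓞 F)).natAbs = 2 := by
  have h : ((Algebra.norm ℤ (-302 + 375 * thetaInt hα + 586 * thetaInt (delta_root hα) : 𝓞 F) : ℤ) : ℚ) = Algebra.norm ℚ (algebraMap (𝓞 F) F (-302 + 375 * thetaInt hα + 586 * thetaInt (delta_root hα))) :=
    Algebra.coe_norm_int _
  have hx : algebraMap (𝓞 F) F (-302 + 375 * thetaInt hα + 586 * thetaInt (delta_root hα)) = ((-302 : ℚ) : F) + ((668 : ℚ) : F) * α + ((293 : ℚ) : F) * α ^ 2 := by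
    simp only [map_mul, map_add, map_neg, map_ofNat, MonicCubic.thetaInt, RingOfIntegers.map_mk]
    push_cast; ring
  rw [hx, norm_lin irreducible_polyQ hα h3] at h
  have hn : normForm 4 19 (-8) (-302) (668) (293) = ((2 : ℤ) : ℚ) := by norm_num [normForm]
  rw [hn] at h
  have h' : Algebra.norm ℤ (-302 + 375 * thetaInt hα + 586 * thetaInt (delta_root hα) : 𝓞 F) = 2 := by exact_mod_cast h
  rw [h']; rfl

/-- `-302 + 375 * θ + 586 * δ` is a prime element of `𝓞_F` (norm `2`). [cite: Marcus2018, Ch. 3, Thm. 27] -/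
theorem prime_piC (h3 : finrank ℚ F = 3) (hα : aeval α (poly 4 19 (-8)) = 0) : Prime (-302 + 375 * thetaInt hα + 586 * thetaInt (delta_root hα) : 𝓞 F) :=
  prime_of_natAbs_norm_prime (by rw [natAbs_norm_piC h3 hα]; norm_num)

/-- **`2` splits completely**: `(-3 + 14 * θ - 9 * δ)·(4625 - 3567 * θ - 12113 * δ)·(-302 + 375 * θ + 586 * δ) = (3476044477 - 8187043950 * θ - 1161624938 * δ)·2` (the cofactor is a unit). [cite: Marcus2018, Ch. 3, Thm. 27 and Exercise 21 (Dedekind)] -/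
theorem prod_dyadic_eq (hα : aeval α (poly 4 19 (-8)) = 0) :
    (-3 + 14 * thetaInt hα - 9 * thetaInt (delta_root hα) : 𝓞 F) * (4625 - 3567 * thetaInt hα - 12113 * thetaInt (delta_root hα)) * (-302 + 375 * thetaInt hα + 586 * thetaInt (delta_root hα)) = (3476044477 - 8187043950 * thetaInt hα - 1161624938 * thetaInt (delta_root hα)) * (((2 : ℕ) : ℤ) : 𝓞 F) := by
  rw [RingOfIntegers.ext_iff]
  simp only [map_mul, map_add, map_sub, map_neg, map_ofNat, map_intCast, MonicCubic.thetaInt, RingOfIntegers.map_mk]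
  push_cast
  linear_combination (((868487338 : F)) + ((-250799225 : F) / 2) * α + ((-17905825 : F)) * α ^ 2 + ((31941981 : F) / 4) * α ^ 3) * cubic_eq hα

/-- **Every prime of `𝓞_F` above `2` is principal**: `2` is the product of the three prime elements above (up to a unit), so a prime `P ∋ 2` is one of
the three principal primes `(π)`. [cite: Marcus2018, Ch. 3, Thm. 27 and Exercise 21] [cite: LMFDB, number field 3.1.8071.1 (class number 1)] -/
theorem isPrincipal_of_mem_primesOver_2 (h3 : finrank ℚ F = 3) (hα : aeval α (poly 4 19 (-8)) = 0) {P : Ideal (𝓞 F)}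
    (hP : P ∈ primesOver (span {((2 : ℕ) : ℤ)}) (𝓞 F)) : Submodule.IsPrincipal P := by
  haveI := hP.1
  have h2 : (((2 : ℕ) : ℤ) : 𝓞 F) ∈ P := by
    have hu : ((2 : ℕ) : ℤ) ∈ P.under ℤ := by
      rw [← hP.2.over]; exact Ideal.mem_span_singleton_self _
    exact hu
  have hmem : (-3 + 14 * thetaInt hα - 9 * thetaInt (delta_root hα) : 𝓞 F) * (4625 - 3567 * thetaInt hα - 12113 * thetaInt (delta_root hα)) * (-302 + 375 * thetaInt hα + 586 * thetaInt (delta_root hα)) ∈ P := by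
    rw [prod_dyadic_eq hα]; exact P.mul_mem_left _ h2
  rcases eq_span_singleton_of_prod_mem hP.1 (prime_piA h3 hα) (prime_piB h3 hα) (prime_piC h3 hα) hmem with h | h | h
  · exact ⟨⟨_, by rw [h, Ideal.submodule_span_eq]⟩⟩
  · exact ⟨⟨_, by rw [h, Ideal.submodule_span_eq]⟩⟩
  · exact ⟨⟨_, by rw [h, Ideal.submodule_span_eq]⟩⟩

/-- `(3, θ + 1) = (269 + 44 * θ + 26 * δ)`, an element of norm `3` (identities checked in `F`, `δ = (α ^ 2 + α) / 2`).
[cite: Marcus2018, Ch. 3, Thm. 27] -/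
theorem span_3_lin1_eq (hα : aeval α (poly 4 19 (-8)) = 0) :
    span {(3 : 𝓞 F), thetaInt hα + 1} = span {269 + 44 * thetaInt hα + 26 * thetaInt (delta_root hα)} := by
  apply le_antisymm
  · rw [span_le]
    rintro x hx
    rcases hx with rfl | hx
    · exact mem_span_singleton'.mpr ⟨-1 + 4 * thetaInt hα - 2 * thetaInt (delta_root hα), by
          rw [RingOfIntegers.ext_iff]
          simp only [map_mul, map_add, map_sub, map_neg, map_ofNat, map_one, MonicCubic.thetaInt, RingOfIntegers.map_mk]
          linear_combination (((34 : F)) + ((-13 : F)) * α) * cubic_eq hα⟩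
    · rw [Set.mem_singleton_iff.mp hx]
      exact mem_span_singleton'.mpr ⟨-3 + 5 * thetaInt hα + 4 * thetaInt (delta_root hα), by
          rw [RingOfIntegers.ext_iff]
          simp only [map_mul, map_add, map_neg, map_ofNat, map_one, MonicCubic.thetaInt, RingOfIntegers.map_mk]
          linear_combination (((101 : F)) + ((26 : F)) * α) * cubic_eq hα⟩
  · rw [span_singleton_le_iff_mem, mem_span_pair]
    exact ⟨-75 * thetaInt hα + 26 * thetaInt (delta_root hα), 269 - 26 * thetaInt hα, by
        rw [RingOfIntegers.ext_iff]
        simp only [map_mul, map_add, map_sub, map_neg, map_ofNat, map_one, MonicCubic.thetaInt, RingOfIntegers.map_mk]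
        linear_combination (0 : F) * cubic_eq hα⟩

/-- `(3, θ ^ 2 + 1) = (-1 + 4 * θ - 2 * δ)`, an element of norm `9` (identities checked in `F`, `δ = (α ^ 2 + α) / 2`).
[cite: Marcus2018, Ch. 3, Thm. 27] -/
theorem span_3_quad_eq (hα : aeval α (poly 4 19 (-8)) = 0) :
    span {(3 : 𝓞 F), thetaInt hα ^ 2 + 1} = span {-1 + 4 * thetaInt hα - 2 * thetaInt (delta_root hα)} := by
  apply le_antisymm
  · rw [span_le]
    rintro x hx
    rcases hx with rfl | hx
    · exact mem_span_singleton'.mpr ⟨269 + 44 * thetaInt hα + 26 * thetaInt (delta_root hα), by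
          rw [RingOfIntegers.ext_iff]
          simp only [map_mul, map_add, map_sub, map_neg, map_ofNat, map_one, MonicCubic.thetaInt, RingOfIntegers.map_mk]
          linear_combination (((34 : F)) + ((-13 : F)) * α) * cubic_eq hα⟩
    · rw [Set.mem_singleton_iff.mp hx]
      exact mem_span_singleton'.mpr ⟨103 + 17 * thetaInt hα + 10 * thetaInt (delta_root hα), by
          rw [RingOfIntegers.ext_iff]
          simp only [map_mul, map_add, map_sub, map_neg, map_pow, map_ofNat, map_one, MonicCubic.thetaInt, RingOfIntegers.map_mk]
          linear_combination (((13 : F)) + ((-5 : F)) * α) * cubic_eq hα⟩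
  · rw [span_singleton_le_iff_mem, mem_span_pair]
    exact ⟨thetaInt hα, -1, by
        rw [RingOfIntegers.ext_iff]
        simp only [map_mul, map_add, map_sub, map_neg, map_pow, map_ofNat, map_one, MonicCubic.thetaInt, RingOfIntegers.map_mk]
        linear_combination (0 : F) * cubic_eq hα⟩

/-- **Every prime of `𝓞_F` above `3` is principal** (Dedekind–Kummer through `θ`, `3 ∤ exponent`, with `polyMod_3` and the generators above).
[cite: Marcus2018, Ch. 3, Thm. 27] [cite: LMFDB, number field 3.1.8071.1 (class number 1)] -/
theorem isPrincipal_of_mem_primesOver_3 (h3 : finrank ℚ F = 3) (hα : aeval α (poly 4 19 (-8)) = 0) {P : Ideal (𝓞 F)}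
    (hP : P ∈ primesOver (span {((3 : ℕ) : ℤ)}) (𝓞 F)) : Submodule.IsPrincipal P := by
  haveI : Fact (Nat.Prime 3) := ⟨by norm_num⟩
  obtain ⟨Qb, hirr, hmon, hdvd, -, hspan⟩ :=
    exists_factor_of_mem_primesOver' irreducible_polyQ hα (by norm_num : Nat.Prime 3)
      (not_dvd_exponent h3 hα (by norm_num) (by norm_num)) hP
  rw [polyMod_3] at hdvd
  rcases hirr.prime.dvd_or_dvd hdvd with h | h
  · have hirr1 : Irreducible (X + 1 : (ZMod 3)[X]) := by
      rw [show (X + 1 : (ZMod 3)[X]) = X - C (-1) by rw [map_neg, map_one, sub_neg_eq_add]]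
      exact irreducible_X_sub_C _
    have hQb : Qb = X + 1 := eq_of_monic_of_associated hmon (by monicity!) (hirr.associated_of_dvd hirr1 h)
    have hPeq := hspan (X + 1) (by rw [hQb]; simp)
    rw [show aeval (thetaInt hα) (X + 1 : ℤ[X]) = thetaInt hα + 1 by
        simp only [map_add, aeval_X, map_one], Nat.cast_ofNat, span_3_lin1_eq hα] at hPeq
    exact ⟨⟨269 + 44 * thetaInt hα + 26 * thetaInt (delta_root hα), by rw [hPeq, Ideal.submodule_span_eq]⟩⟩
  · have hQb : Qb = X ^ 2 + 1 :=
      eq_of_monic_of_associated hmon (by monicity!) (hirr.associated_of_dvd irreducible_quad_3 h)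
    have hPeq := hspan (X ^ 2 + 1) (by rw [hQb]; simp)
    rw [show aeval (thetaInt hα) (X ^ 2 + 1 : ℤ[X]) = thetaInt hα ^ 2 + 1 by
        simp only [map_add, map_pow, aeval_X, map_one], Nat.cast_ofNat, span_3_quad_eq hα] at hPeq
    exact ⟨⟨-1 + 4 * thetaInt hα - 2 * thetaInt (delta_root hα), by rw [hPeq, Ideal.submodule_span_eq]⟩⟩

/-- **Every prime of `𝓞_F` above `5` is principal**: `5` is inert (`f` irreducible mod `5`, `5 ∤ exponent`), so `P = (5)`.
[cite: Marcus2018, Ch. 3, Thm. 27] [cite: LMFDB, number field 3.1.8071.1 (class number 1)] -/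
theorem isPrincipal_of_mem_primesOver_5 (h3 : finrank ℚ F = 3) (hα : aeval α (poly 4 19 (-8)) = 0) {P : Ideal (𝓞 F)}
    (hP : P ∈ primesOver (span {((5 : ℕ) : ℤ)}) (𝓞 F)) : Submodule.IsPrincipal P := by
  have hPeq := eq_span_of_no_root' irreducible_polyQ hα (by norm_num : Nat.Prime 5)
    (not_dvd_exponent h3 hα (by norm_num) (by norm_num)) hP no_root_5
  exact ⟨⟨((5 : ℕ) : 𝓞 F), by rw [hPeq, Ideal.submodule_span_eq]⟩⟩

/-- `(7, θ + 4) = (-479 - 2334 * θ + 5154 * δ)`, an element of norm `7` (identities checked in `F`, `δ = (α ^ 2 + α) / 2`).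
[cite: Marcus2018, Ch. 3, Thm. 27] -/
theorem span_7_lin4_eq (hα : aeval α (poly 4 19 (-8)) = 0) :
    span {(7 : 𝓞 F), thetaInt hα + 4} = span {-479 - 2334 * thetaInt hα + 5154 * thetaInt (delta_root hα)} := by
  apply le_antisymm
  · rw [span_le]
    rintro x hx
    rcases hx with rfl | hx
    · exact mem_span_singleton'.mpr ⟨2586256759 + 423205014 * thetaInt hα + 249932478 * thetaInt (delta_root hα), by
          rw [RingOfIntegers.ext_iff]
          simp only [map_mul, map_add, map_sub, map_neg, map_ofNat, MonicCubic.thetaInt, RingOfIntegers.map_mk]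
          linear_combination (((154852123446 : F)) + ((322037997903 : F)) * α) * cubic_eq hα⟩
    · rw [Set.mem_singleton_iff.mp hx]
      exact mem_span_singleton'.mpr ⟨1620679564 + 265201711 * thetaInt hα + 156620358 * thetaInt (delta_root hα), by
          rw [RingOfIntegers.ext_iff]
          simp only [map_mul, map_add, map_sub, map_neg, map_ofNat, MonicCubic.thetaInt, RingOfIntegers.map_mk]
          linear_combination (((97038188895 : F)) + ((201805331283 : F)) * α) * cubic_eq hα⟩
  · rw [span_singleton_le_iff_mem, mem_span_pair]
    exact ⟨479 - 1376 * thetaInt hα - 50 * thetaInt (delta_root hα), -958 + 2752 * thetaInt hα, by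
        rw [RingOfIntegers.ext_iff]
        simp only [map_mul, map_add, map_sub, map_neg, map_ofNat, MonicCubic.thetaInt, RingOfIntegers.map_mk]
        linear_combination (0 : F) * cubic_eq hα⟩

/-- `(7, θ + 3) = (-5 + 6 * θ + 10 * δ)`, an element of norm `-7` (identities checked in `F`, `δ = (α ^ 2 + α) / 2`).
[cite: Marcus2018, Ch. 3, Thm. 27] -/
theorem span_7_lin3_eq (hα : aeval α (poly 4 19 (-8)) = 0) :
    span {(7 : 𝓞 F), thetaInt hα + 3} = span {-5 + 6 * thetaInt hα + 10 * thetaInt (delta_root hα)} := by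
  apply le_antisymm
  · rw [span_le]
    rintro x hx
    rcases hx with rfl | hx
    · exact mem_span_singleton'.mpr ⟨-8299 - 1358 * thetaInt hα - 802 * thetaInt (delta_root hα), by
          rw [RingOfIntegers.ext_iff]
          simp only [map_mul, map_add, map_sub, map_neg, map_ofNat, MonicCubic.thetaInt, RingOfIntegers.map_mk]
          linear_combination (((-5186 : F)) + ((-2005 : F)) * α) * cubic_eq hα⟩
    · rw [Set.mem_singleton_iff.mp hx]
      exact mem_span_singleton'.mpr ⟨-4015 - 657 * thetaInt hα - 388 * thetaInt (delta_root hα), by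
          rw [RingOfIntegers.ext_iff]
          simp only [map_mul, map_add, map_sub, map_neg, map_ofNat, MonicCubic.thetaInt, RingOfIntegers.map_mk]
          linear_combination (((-2509 : F)) + ((-970 : F)) * α) * cubic_eq hα⟩
  · rw [span_singleton_le_iff_mem, mem_span_pair]
    exact ⟨-5 - 4 * thetaInt hα - 2 * thetaInt (delta_root hα), 10 + 12 * thetaInt hα, by
        rw [RingOfIntegers.ext_iff]
        simp only [map_mul, map_add, map_sub, map_neg, map_ofNat, MonicCubic.thetaInt, RingOfIntegers.map_mk]
        linear_combination (0 : F) * cubic_eq hα⟩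

/-- **Every prime of `𝓞_F` above `7` is principal** (Dedekind–Kummer through `θ`, `7 ∤ exponent`, with `polyMod_7` and the generators above).
[cite: Marcus2018, Ch. 3, Thm. 27] [cite: LMFDB, number field 3.1.8071.1 (class number 1)] -/
theorem isPrincipal_of_mem_primesOver_7 (h3 : finrank ℚ F = 3) (hα : aeval α (poly 4 19 (-8)) = 0) {P : Ideal (𝓞 F)}
    (hP : P ∈ primesOver (span {((7 : ℕ) : ℤ)}) (𝓞 F)) : Submodule.IsPrincipal P := by
  haveI : Fact (Nat.Prime 7) := ⟨by norm_num⟩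
  obtain ⟨Qb, hirr, hmon, hdvd, -, hspan⟩ :=
    exists_factor_of_mem_primesOver' irreducible_polyQ hα (by norm_num : Nat.Prime 7)
      (not_dvd_exponent h3 hα (by norm_num) (by norm_num)) hP
  rw [polyMod_7] at hdvd
  rcases hirr.prime.dvd_or_dvd hdvd with h12 | h
  · rcases hirr.prime.dvd_or_dvd h12 with h | h
    · have hirr1 : Irreducible (X + 4 : (ZMod 7)[X]) := by
        rw [show (X + 4 : (ZMod 7)[X]) = X - C (-4) by rw [map_neg, map_ofNat]; ring]
        exact irreducible_X_sub_C _
      have hQb : Qb = X + 4 := eq_of_monic_of_associated hmon (by monicity!) (hirr.associated_of_dvd hirr1 h)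
      have hPeq := hspan (X + C 4) (by rw [hQb]; simp [map_ofNat])
      rw [show aeval (thetaInt hα) (X + C 4 : ℤ[X]) = thetaInt hα + 4 by
          simp only [map_add, aeval_X, aeval_C, algebraMap_int_eq, Int.coe_castRingHom, Int.cast_ofNat], Nat.cast_ofNat, span_7_lin4_eq hα] at hPeq
      exact ⟨⟨-479 - 2334 * thetaInt hα + 5154 * thetaInt (delta_root hα), by rw [hPeq, Ideal.submodule_span_eq]⟩⟩
    · have hirr1 : Irreducible (X + 4 : (ZMod 7)[X]) := by
        rw [show (X + 4 : (ZMod 7)[X]) = X - C (-4) by rw [map_neg, map_ofNat]; ring]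
        exact irreducible_X_sub_C _
      have hQb : Qb = X + 4 := eq_of_monic_of_associated hmon (by monicity!) (hirr.associated_of_dvd hirr1 h)
      have hPeq := hspan (X + C 4) (by rw [hQb]; simp [map_ofNat])
      rw [show aeval (thetaInt hα) (X + C 4 : ℤ[X]) = thetaInt hα + 4 by
          simp only [map_add, aeval_X, aeval_C, algebraMap_int_eq, Int.coe_castRingHom, Int.cast_ofNat], Nat.cast_ofNat, span_7_lin4_eq hα] at hPeq
      exact ⟨⟨-479 - 2334 * thetaInt hα + 5154 * thetaInt (delta_root hα), by rw [hPeq, Ideal.submodule_span_eq]⟩⟩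
  · have hirr1 : Irreducible (X + 3 : (ZMod 7)[X]) := by
      rw [show (X + 3 : (ZMod 7)[X]) = X - C (-3) by rw [map_neg, map_ofNat]; ring]
      exact irreducible_X_sub_C _
    have hQb : Qb = X + 3 := eq_of_monic_of_associated hmon (by monicity!) (hirr.associated_of_dvd hirr1 h)
    have hPeq := hspan (X + C 3) (by rw [hQb]; simp [map_ofNat])
    rw [show aeval (thetaInt hα) (X + C 3 : ℤ[X]) = thetaInt hα + 3 by
        simp only [map_add, aeval_X, aeval_C, algebraMap_int_eq, Int.coe_castRingHom, Int.cast_ofNat], Nat.cast_ofNat, span_7_lin3_eq hα] at hPeq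
    exact ⟨⟨-5 + 6 * thetaInt hα + 10 * thetaInt (delta_root hα), by rw [hPeq, Ideal.submodule_span_eq]⟩⟩

end NumberField

end Literature.NumberTheory.CubicFields.CubicDisc8071

end
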